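import Summits.Langlands.Langlands.Theorems.IrreducibilityBySelfDualityReciprocityUpToIrreducibilityRDualProbes
import Summits.Langlands.Langlands.Theorems.IrreducibilityBySelfDualityReciprocityUpToIrreducibilityRInvariantsHomDual
import HarnessLib

/-!
# Stub F3a `stub_dualProbe` for line `PhantomRMJunctionOfPieces`
# (crux stmt-Langlands-13643 `PhantomRMYoshida.PhantomRMJunction`)

**Admissible dual probes on coordinates.**  Every Weil–Deligne representation `X` of `W_F` on a
finite-dimensional complex space `U` admits a Weil–Deligne representation `τ` on the coordinate
space `Fin (dim U) → ℂ` — the transport of the contragredient `X^∨` along a linear isomorphism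
`U^* ≃ ℂ^{dim U}` — such that `τ` is Frobenius-semisimple, resp. indecomposable, when `X` is, and
such that for every finite-dimensional `σ` on `V` the Weil–Deligne invariants
`ker N_{σ ⊗ τ} ⊓ (V ⊗ ℂ^{dim U})^{W_F}` have the dimension of `Hom_WD(X, σ)`.

The proof is a corollary of the dual-probe machinery of the sibling crux stmt-Langlands-17925
(line `Sketch`), imported by name from
`Theorems/IrreducibilityBySelfDualityReciprocityUpToIrreducibilityRDualProbes.lean`
(`exists_isEquivalent_transport`, `isIndecomposable_of_equiv`, `isIndecomposable_dual`,
`isEquivalent_dual_of_equiv`, `isEquivalent_dual_dual`, `finrank_homWD_eq_of_equiv`),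
`…RReducibleEulerPole.lean` (`isFrobSemisimple_of_equiv`, `isFrobSemisimple_dual`) and
`…RInvariantsHomDual.lean` (the bridge `stub_finrank_invariants_tprod_eq_finrank_homWD_dual`:
`dim (ker N_{σ⊗τ} ⊓ (V ⊗ W)^{W_F}) = dim Hom_WD(τ^∨, σ)`), combined as
`dim (ker ⊓ inv)(σ ⊗ τ) = dim Hom_WD(τ^∨, σ) = dim Hom_WD(X^∨∨, σ) = dim Hom_WD(X, σ)`
(`τ^∨ ≅ X^∨∨ ≅ X`).  The `LocalGaloisGroup` facts feeding `WeilDeligneRep.dual` are the discharged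
`IsFrobPow.mul_holds`, `IsFrobPow.unique_holds`.

Ref: Deligne, Antwerp II, LNM 349 (1973), §8.4; Tate, Corvallis 1979, (4.1.2)–(4.1.6);
Henniart, Bull. SMF 130 (2002), §1.7.  No definitions, no named facts.
-/

noncomputable section

set_option linter.dupNamespace false -- `Summit.Langlands.Langlands` is the mandated namespace

open Module
open Literature.NumberTheory.Automorphic Literature.NumberTheory.GaloisRepresentations
open Literature.NumberTheory.GaloisRepresentations.WeilGroup
open Summit.Langlands.Langlands.Theorems.ReciprocityUpToIrreducibilityR

namespace Summit.Langlands.Langlands.Theorems.PhantomRMJunctionOfPieces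

/-- **Registered stub F3a `stub_dualProbe` (admissible dual probes on coordinates).**  For a
Weil–Deligne representation `X` on a finite-dimensional `U`, the transport `τ` of the
contragredient `X^∨` to `Fin (dim U) → ℂ` is Frobenius-semisimple (resp. indecomposable) when `X`
is, and `dim (ker N_{σ⊗τ} ⊓ (V ⊗ ℂ^{dim U})^{W_F}) = dim Hom_WD(τ^∨, σ) = dim Hom_WD(X, σ)` for every
finite-dimensional `σ`, since `τ^∨ ≅ X^∨∨ ≅ X`. [cite: TateCorvallis1979, (4.1.6)] -/
theorem stub_dualProbe : ∀ (F : Type) [Field F] [ValuativeRel F] [TopologicalSpace F] [IsNonarchimedeanLocalField F] (U : Type) [AddCommGroup U] [Module ℂ U] [FiniteDimensional ℂ U] (X : WeilDeligneRep F ℂ U), ∃ τ : WeilDeligneRep F ℂ (Fin (Module.finrank ℂ U) → ℂ), (X.IsFrobSemisimple → τ.IsFrobSemisimple) ∧ (X.IsIndecomposable → τ.IsIndecomposable) ∧ ∀ (V : Type) [AddCommGroup V] [Module ℂ V] [FiniteDimensional ℂ V] (σ : WeilDeligneRep F ℂ V), Module.finrank ℂ ↥(LinearMap.ker (σ.tprod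 τ).N ⊓ (σ.tprod τ).ρ.invariants) = Module.finrank ℂ ↥(Summit.Langlands.Langlands.Theorems.ReciprocityUpToIrreducibilityR.homWD X σ) := by
  intro F _ _ _ _ U _ _ _ X
  have hmul : IsFrobPow.mul (F := F) := IsFrobPow.mul_holds
  have huniq : IsFrobPow.unique (F := F) := IsFrobPow.unique_holds
  -- transport `X^∨` (on `U^*`) to the coordinate space `Fin (dim U) → ℂ`
  let e : Module.Dual ℂ U ≃ₗ[ℂ] (Fin (finrank ℂ U) → ℂ) :=
    LinearEquiv.ofFinrankEq _ _ (by rw [Subspace.dual_finrank_eq, Module.finrank_fin_fun])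
  obtain ⟨τ, ⟨eτ⟩⟩ := exists_isEquivalent_transport (X.dual hmul huniq) e
  refine ⟨τ, fun hX => isFrobSemisimple_of_equiv eτ (isFrobSemisimple_dual hmul huniq X hX),
    fun hX => isIndecomposable_of_equiv eτ (isIndecomposable_dual hmul huniq X hX),
    fun V _ _ _ σ => ?_⟩
  -- `τ^∨ ≅ X^∨∨ ≅ X`, and `dim Hom_WD(·, σ)` is an isomorphism invariant
  obtain ⟨e₁⟩ := isEquivalent_dual_of_equiv hmul huniq eτ.symm
  obtain ⟨e₂⟩ := isEquivalent_dual_dual hmul huniq X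
  rw [stub_finrank_invariants_tprod_eq_finrank_homWD_dual F hmul huniq V (Fin (finrank ℂ U) → ℂ) σ τ,
    finrank_homWD_eq_of_equiv e₁ σ, ← finrank_homWD_eq_of_equiv e₂ σ]

end Summit.Langlands.Langlands.Theorems.PhantomRMJunctionOfPieces

end
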